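import Summits.QuantumFields.BalabanUV.T4Continuum.Spine.NE1p.DressedRootWin

/-!
# T⁴ programme, spine estimate NE1′ (node O3b/H2) — leaf F-5 with PER-STEP CHART WINDOWS: the window schedule for END-F-win
# and a CUTOFF-FREE witness (swarm row S1c «S1-win» of `t4/formal/NE1p/LEAVES.md`, schedule half; DAG node N21c)

Cell `pub-balaban`, sub-cell `t4`, BINDER-OWNERS row NE1′, formalisation swarm `b2b-balaban-t4-ne1p-formalise-*`, seat
`b2b-balaban-t4-ne1p-formalise-leaf-04` (rows S1 `DressedWindowSchedule` p212498, S1b `DressedTransportScheduled` p212785);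
tree target `Summits/QuantumFields/BalabanUV/T4Continuum/Spine/NE1p/`; ADDITIVE — imports leaf-08's `Spine/NE1p/DressedRootWin`
(END-F-win `transportLeaf_of_centredExponent_win`, p213121) ONLY; modifies nothing.

WHY.  Row S1's schedule serves END-F, whose nesting (N2) is asked for ALL chart motions of the uniform bound `w`, so every met
step consumes at least `w` of window radius (`WindowSchedule.window_budget`: `ρw K + K·w ≤ ρw 0` — swarm finding F-ne1pleaf08-1
(4), caveat LF-1).  END-F-win (leaf-08, row «R-b») asks (N2) only for motions of bound `≤ wk b k′ (k+1)`, a per-step window.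
This file is the matching schedule: §1 **`WindowScheduleWin r w`** — window radii `ρw k`, fluctuation radii `σ k`, chart radii
`ϱc k` and PER-STEP CHART WINDOWS `wc k` with `0 < σ k`, `2σ k ≤ wc k ≤ w`, `wc (k+1) ≤ wc k`, `0 < ϱc k` and THE GAP
`ρw (k+1) + wc (k+1) + σ k ≤ ρw k` (NO uniform `w` and NO radius in the gap); §2 the discharges, in END-F-win's verbatim binder
shapes with `𝒦 b k′ k := bondBall d (ρw k)`, `D b k := bondBall d (σ k)`, `θ b k := 2σ k`, `ϱ b k′ k := ϱc k`,
`wk b k′ k := wc k`: the NEW ones `hN2` (per-step form), `hθwk`, `hwk`, `hwk_anti` as lemmas, the five shared with row S1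
(`hD`, `hϱ`, `hN1`, `hdiam`, `hθ` — same one-liners over `bondBall_add_mem`/`bondBall_diam` as `DressedWindowSchedule.h*_of_schedule`)
inlined in §3; §3
**`transportLeaf_win_of_schedule`** = END-F-win with those nine binders gone, conclusion VERBATIM the field type of
`BookingLeaves.htr`; §4 **THE CUTOFF-FREE WITNESS** `WindowScheduleWin.geometric`: `σ k = σ₀q^k`, `wc k = 2σ₀q^k`, `ϱc ≡ ϱ₀`,
`ρw k = ρ∞ + c·q^k` with `c = (1 + 2q)σ₀/(1 − q)`: the gap holds with EQUALITY, the birth window is `ρw 0 = ρ∞ + c` and EVERY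
window contains `bondBall d ρ∞` — the total (N1)/(N2) consumption along an arbitrarily long run is `≤ c`, CUTOFF-FREE
(`geometric_window_le`, `geometric_window_ge`, contrast `WindowSchedule.window_budget`), and the (w4) ratio is `θ/ϱ = 2σ₀q^k/ϱ₀
≤ 2σ₀/ϱ₀`, cutoff-free (`geometric_ratio_le`).  This is the cell's birth-frame reading («a unit scale-k fluctuation read in the
j-frame has size O(L^{−(k−j)})», `T4BirthChartTransport.slice_bound` docstring; `q` ↔ `L⁻¹`) turned into schedule arithmetic —
a BINDER's witness, nothing of Bałaban's windows asserted.

LOCATED CAVEAT LF-1 (4′) (this seat, journal `CLAIM NE1p-S1c`).  The cutoff-freeness above is for END-F-win WITH `hP` DISPLAYED.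
Assembling `hP` by `T4TrajectoryDensityAssembly(Mod).pertSlice_under_history(_mod)` re-introduces the uniform slice window `w`
once per met step through the cross-family complex margin `hN2cx : … latN pd ≤ w → ∀ t ∈ tube (ϱ₁ b k / latN pd), latMove U₀ pd t
+ z₁ b k ∈ 𝒦 p.1 p.2 k` (bond balls: gap `≥ w + ϱ₁ k + σ k`, i.e. `window_budget`'s `K·w` again), because END-F(-win)'s `hP` is
typed at the uniform direction window `w`.  The slice shapes `BirthSlice`/`ExponentSliceAt`/`PertSlice` are `∀ d, 0 < N d →
N d ≤ w → …`, antitone in `w`, so the cure is typed: per-step slice windows `wk b k′ (k+1)` for `hsl`/`hE`/`hP` up the `_win` chain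
(«S1c²», offered; not in this file).  Recorded, not resolved.

HONEST FRAMING.  Rung (B)+1 bookkeeping on ONE finite four-torus of fixed physical size — NOT infinite volume, NOT a mass gap,
NOT OS on ℝ⁴, NOT the Clay problem, NOT summit progress.  NE1′ is NOT PRINTED and NOT PROVED; this file reads «END-F-win's
window geometry ⇐ a per-step window schedule», never «NE1′ proved».  [folklore] lattice geometry (triangle inequality) and
kernel glue, 0 sorry, 0 citations used as facts, no `def … : Prop`; the schedule is a BINDER — no radius or window of Bałaban's
([Balaban1989LargeFieldI] p. 190, (1.27) p. 187: printed TYPE only) is asserted, and whether a geometric schedule fits inside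
the printed windows along a family's history is (w3)⁺'s located content (OWNER-ANSWERS-g23 §F/§G), untouched.  Every estimate
binder ((w1) `hsl`, H2 `hFn`/`h𝒢`, (w2-act) `hB`/`hE`, `hP`, `hDμ`, (w4) `hdom`, (I4′) `hdefwk`/`hrate`, attainment `hlin`,
invariance) stays displayed.  Spine PROVED 0∕9 unchanged.  HONEST DEPENDENCY: continuum YM on T⁴ ⇐ BetaPertH ∧ nine spine
estimates (0/9 proved); BetaPertH ⇐ (D1) ∧ (D4) ∧ CAP+tail; G-an2-4 gates asym, D1 and NE2/3/4.
-/

noncomputable section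

namespace Summit.QuantumFields.BalabanUV.T4Continuum.NE1p.DressedWindowScheduleWin

open MeasureTheory Set Metric Finset
open scoped BigOperators
open Literature.MathematicalPhysics.QuantumFieldTheory.Balaban1983to89
open Literature.MathematicalPhysics.QuantumFieldTheory.Balaban1983to89.T4TermFormat
open Literature.MathematicalPhysics.QuantumFieldTheory.Balaban1983to89.T4GatedBooking
open Literature.MathematicalPhysics.QuantumFieldTheory.Balaban1983to89.T4TrajectoryComparison
open Literature.MathematicalPhysics.QuantumFieldTheory.Balaban1983to89.T4TrajectoryModulus
open T4BirthChartTransport (GaugeInvariant BirthSlice RelGauge)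
open T4BlockTransport (Fld NDir latMove latN)
open T4TrajectoryDensity
open Summit.QuantumFields.BalabanUV.T4Continuum.T4TrajectoryDensityDressed
open Summit.QuantumFields.BalabanUV.T4Continuum.NE1p.DressedRootWin

/-! ## §1 The per-step window schedule: data and located inequalities -/

/-- **A WINDOW SCHEDULE WITH PER-STEP CHART WINDOWS** for birth radius `r` and slice window `w` [data + hypothesis shapes]: per
step `k`, the window radius `ρw k`, the fluctuation radius `σ k` (diameter `2σ k`), the complex chart radius `ϱc k`, and the
CHART WINDOW `wc k` of the step (the declared bound of the chart motions (N2) is asked for, dominating the fluctuation diameter and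
the pair defects of that step), with: `0 < σ k`, `2σ k ≤ wc k ≤ w`, `wc (k+1) ≤ wc k`, `0 < ϱc k`, and THE GAP
`ρw (k+1) + wc (k+1) + σ k ≤ ρw k` — the window of step `k+1`, moved by a chart motion of bound `wc (k+1)` and translated by a
step-`k` fluctuation, lies in the window of step `k`.  No radius and no uniform `w` enter the gap.  Numbers and inequalities
only — a BINDER of the instantiation; NOT asserted for Bałaban's windows. [folklore] -/
structure WindowScheduleWin (r w : ℝ) where
  /-- window radius at step `k` -/
  ρw : ℕ → ℝ
  /-- fluctuation radius at step `k` -/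
  σ : ℕ → ℝ
  /-- complex chart radius granted at step `k` -/
  ϱc : ℕ → ℝ
  /-- chart window of step `k` -/
  wc : ℕ → ℝ
  hσ : ∀ k, 0 < σ k
  hσwc : ∀ k, 2 * σ k ≤ wc k
  hwcw : ∀ k, wc k ≤ w
  hwc_anti : ∀ k, wc (k + 1) ≤ wc k
  hϱc : ∀ k, 0 < ϱc k
  /-- THE GAP between consecutive windows, per-step form -/
  hgap : ∀ k, ρw (k + 1) + wc (k + 1) + σ k ≤ ρw k

namespace WindowScheduleWin

variable {r w : ℝ} (W : WindowScheduleWin r w)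

/-- [arith] [folklore] Chart windows are positive (they dominate a positive diameter). -/
theorem wc_pos (k : ℕ) : 0 < W.wc k := lt_of_lt_of_le (by linarith [W.hσ k]) (W.hσwc k)
/-- [arith] [folklore] The slice window dominates the (positive) chart windows. -/
theorem w_pos (W : WindowScheduleWin r w) : 0 < w := (W.wc_pos 0).trans_le (W.hwcw 0)
/-- [arith] [folklore] The fluctuation part of THE GAP: a step-`k` fluctuation radius fits between consecutive windows, with the
chart window of the next step to spare. -/
theorem σ_add_wc_le_gap (k : ℕ) : W.σ k + W.wc (k + 1) ≤ W.ρw k - W.ρw (k + 1) := by linarith [W.hgap k]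

/-- **THE CONSUMPTION OF THIS SCHEDULE** [arith]: after `K` steps the birth window exceeds the final one by EXACTLY what the
gaps consumed, `Σ_{k<K} (ρw k − ρw (k+1)) = ρw 0 − ρw K`, and each gap is only asked to dominate `wc (k+1) + σ k` — summable data
when `wc`, `σ` are geometric (§4), in contrast with the uniform-window schedule's `K·w` (`WindowSchedule.window_budget`). [folklore] -/
theorem consumption_le (K : ℕ) : ∑ k ∈ Finset.range K, (W.wc (k + 1) + W.σ k) ≤ W.ρw 0 - W.ρw K := by
  induction K with
  | zero => simp
  | succ K ih =>
    rw [Finset.sum_range_succ]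
    have h := W.hgap K
    linarith

end WindowScheduleWin

/-! ## §2 The schedule discharges END-F-win's NEW geometric binders, in their verbatim shapes
(the binders shared with END-F — `hD`, `hϱ`, `hN1`, `hdiam`, `hθ` — are discharged inline in §3 by the same one-liners as row S1's
`DressedWindowSchedule.hD_of_schedule` … `hθ_of_schedule`; not restated here) -/

section Binders

variable {r w : ℝ} (W : WindowScheduleWin r w)
variable {B : T4TermFormat.Booking} {R : Type*} [NormedRing R] {d : ℕ}

/-- **`hθwk`** of END-F-win [folklore]: the diameter is within the step's chart window. -/
theorem hθwk_of_schedule : ∀ (_b : B.Birth) (_k' k : ℕ), 2 * W.σ k ≤ W.wc k := fun _ _ k => W.hσwc k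

/-- **`hwk`** of END-F-win [folklore]: chart windows are within the slice window. -/
theorem hwk_of_schedule : ∀ (_b : B.Birth) (_k' k : ℕ), W.wc k ≤ w := fun _ _ k => W.hwcw k

/-- **`hwk_anti`** of END-F-win [folklore]: chart windows do not increase. -/
theorem hwk_anti_of_schedule : ∀ (_b : B.Birth) (_k' k : ℕ), W.wc (k + 1) ≤ W.wc k := fun _ _ k => W.hwc_anti k

variable [NormedAlgebra ℂ R]

/-- **`hN2`** of END-F-win [folklore] (NESTING (N2), PER-STEP WINDOW): the step-`(k+1)` window moved by a chart motion of bound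
`≤ wc (k+1)` and translated by a step-`k` fluctuation lies in the step-`k` window — `bondBall_latMove_add_mem` on THE GAP. -/
theorem hN2_of_schedule :
    ∀ (b : B.Birth) (k' k : ℕ), B.birthScale b ≤ k' → k' ≤ k → k + 1 ≤ B.K →
      ∀ U₀ ∈ (bondBall d (W.ρw (k + 1)) : Set (Fld d R)), ∀ p : NDir d R, latN p ≤ W.wc (k + 1) →
        ∀ z' ∈ (bondBall d (W.σ k) : Set (Fld d R)), latMove U₀ p 1 + z' ∈ (bondBall d (W.ρw k) : Set (Fld d R)) :=
  fun _ _ k _ _ _ => bondBall_latMove_add_mem (W.hgap k)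

end Binders

/-! ## §3 Composition: END-F-win with its geometry discharged by the schedule -/

section Composition

variable {r w : ℝ} (W : WindowScheduleWin r w)
variable {B : T4TermFormat.Booking} {T : Trajectory B}
variable {R : Type*} [NormedRing R] [NormedAlgebra ℂ R] [MeasurableSpace R] {d : ℕ}
  {F : Type*} [NormedAddCommGroup F] [NormedSpace ℂ F] [CompleteSpace F]

/-- **END-F-win UNDER A PER-STEP WINDOW SCHEDULE** [bookkeeping]: `DressedRootWin.transportLeaf_of_centredExponent_win` with
windows `𝒦 b k′ k := bondBall d (ρw k)`, fluctuation domains `D b k := bondBall d (σ k)`, diameters `θ b k := 2σ k`, chart radii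
`ϱ b k′ k := ϱc k` and chart windows `wk b k′ k := wc k` read off the schedule — its binders `hD`, `hϱ`, `hN1`, `hN2`, `hdiam`,
`hθ`, `hθwk`, `hwk`, `hwk_anti` are DISCHARGED (§2); (w4) reads `e³·(1 + 4·(2σ k)/ϱc k) ≤ α k`, the defects (I4′) are asked below
the step's chart window (`hdefwk : defect b k′ k ≤ wc k`).  Displayed: (w1) `hsl`, H2 `hFn`/`h𝒢`, (w2-act) `hB`/`hE`, `hP`, `hDμ`,
(w4) `hdom`, invariance, (I4′) `hdefwk`/`hrate`, attainment `hlin`.  Conclusion: VERBATIM the field type of `BookingLeaves.htr` with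
`C = 4c_δ/r`, `ρ i = ψ·α i`. [folklore] -/
theorem transportLeaf_win_of_schedule {Fn : B.Birth → ℕ → ℕ → Fld d R → F}
    {rel : B.Birth → ℕ → ℕ → Fld d R → Fld d R → Prop}
    {ref : B.Birth → ℕ → Fld d R → Fld d R} {base : B.Birth → ℕ → Fld d R → ℝ}
    {𝒜 𝒬 : B.Birth → ℕ → Fld d R → Fld d R → ℂ} {q : B.Birth → ℕ → Fld d R → ℂ}
    {μ : B.Birth → ℕ → Measure (Fld d R)} {z₀ : B.Birth → ℕ → Fld d R}
    {defect : B.Birth → ℕ → ℕ → ℝ} {cδ ψ m : ℝ} {s : B.Birth → ℕ → ℝ} {α : ℕ → ℝ}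
    {S : ℕ → B.Birth → Finset B.Birth}
    (hα : ∀ i, 0 ≤ α i) (hr : 0 < r)
    (hsl : ∀ (b : B.Birth) (k' : ℕ), B.birthScale b ≤ k' → k' ≤ B.K →
      RanBelow (budgetGate T s m S (4 * cδ / r) (fun i => ψ * α i)) k' →
      BirthSlice (Fn b k' k') latMove latN (bondBall d (W.ρw k') : Set (Fld d R)) w r (T.gen b k'))
    (hFn : ∀ (b : B.Birth) (k' k : ℕ), B.birthScale b ≤ k' → k' ≤ k → k + 1 ≤ B.K →
      RanBelow (budgetGate T s m S (4 * cδ / r) (fun i => ψ * α i)) (k + 1) →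
      ∀ U, Fn b k' (k + 1) U =
        wOp (expWeight (base b k) (𝒜 b k + 𝒬 b k)) (μ b k) (z₀ b k) U (fun z => Fn b k' k (U + z)))
    (h𝒢 : ∀ (b : B.Birth) (k' k : ℕ), B.birthScale b ≤ k' → k' ≤ k → k + 1 ≤ B.K →
      RanBelow (budgetGate T s m S (4 * cδ / r) (fun i => ψ * α i)) (k + 1) →
      ∀ U, (fun z => Fn b k' k (U + z)) ∈ BddClass F (μ b k))
    (hB : ∀ (b : B.Birth) (k' k : ℕ), B.birthScale b ≤ k' → k' ≤ k → k + 1 ≤ B.K →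
      RanBelow (budgetGate T s m S (4 * cδ / r) (fun i => ψ * α i)) (k + 1) →
      RealBaseAt (ref b k) (base b k) (𝒜 b k) (μ b k) (bondBall d (W.ρw (k + 1)) : Set (Fld d R)))
    (hE : ∀ (b : B.Birth) (k' k : ℕ), B.birthScale b ≤ k' → k' ≤ k → k + 1 ≤ B.K →
      RanBelow (budgetGate T s m S (4 * cδ / r) (fun i => ψ * α i)) (k + 1) →
      ExponentSliceAt (ref b k) (𝒜 b k) (μ b k) latMove latN (bondBall d (W.ρw (k + 1)) : Set (Fld d R)) w (W.ϱc k)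
        (s b k))
    (hP : ∀ (b : B.Birth) (k' k : ℕ), B.birthScale b ≤ k' → k' ≤ k → k + 1 ≤ B.K →
      RanBelow (budgetGate T s m S (4 * cδ / r) (fun i => ψ * α i)) (k + 1) →
      PertSlice (fun U z => 𝒬 b k U z - q b k U) (μ b k) latMove latN (bondBall d (W.ρw (k + 1)) : Set (Fld d R)) w
        (W.ϱc k) (m * ∑ f ∈ S k b, T.envVar (4 * cδ / r) (fun i => ψ * α i) f k))
    (hDμ : ∀ b k, ∀ᵐ z ∂μ b k, z ∈ (bondBall d (W.σ k) : Set (Fld d R)))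
    (hdom : ∀ k, k + 1 ≤ B.K → Real.exp 3 * (1 + 4 * (2 * W.σ k) / W.ϱc k) ≤ α k)
    (hinv : ∀ b k' k, GaugeInvariant (rel b k' k) (Fn b k' k))
    (hdefwk : ∀ (_b : B.Birth) (_k' k : ℕ), defect _b _k' k ≤ W.wc k)
    (hrate : ∀ (b : B.Birth) (k' k : ℕ), B.birthScale b ≤ k' → k' ≤ k → k ≤ B.K →
      defect b k' k ≤ cδ * ψ ^ (k - k'))
    (hlin : ∀ (b : B.Birth) (k' k : ℕ), B.birthScale b ≤ k' → k' ≤ k → k ≤ B.K →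
      RanBelow (budgetGate T s m S (4 * cδ / r) (fun i => ψ * α i)) k → ∀ ε > 0,
      ∃ U₀ ∈ (bondBall d (W.ρw k) : Set (Fld d R)), ∃ U₁ : Fld d R,
        RelGauge (rel b k' k) latMove latN U₀ U₁ (defect b k' k) ∧
        T.lin b k' k ≤ ‖Fn b k' k U₁ - Fn b k' k U₀‖ + ε) :
    T.TransportsFromVar (4 * cδ / r) (fun i => ψ * α i) (budgetGate T s m S (4 * cδ / r) (fun i => ψ * α i)) :=
  transportLeaf_of_centredExponent_win (𝒦 := fun _ _ k => (bondBall d (W.ρw k) : Set (Fld d R)))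
    (D := fun _ k => (bondBall d (W.σ k) : Set (Fld d R))) (θ := fun _ k => 2 * W.σ k) (ϱ := fun _ _ k => W.ϱc k)
    (wk := fun _ _ k => W.wc k)
    hα hr W.w_pos hsl hFn h𝒢 (fun _ k => ⟨0, fun x ν => by simpa using (W.hσ k).le⟩) (fun _ _ k => W.hϱc k) hB hE hP hDμ
    (fun _ _ k _ _ _ => bondBall_add_mem (by linarith [W.σ_add_wc_le_gap k, W.wc_pos (k + 1)])) (hN2_of_schedule W)
    (fun _ _ => bondBall_diam) (fun _ k => ⟨by linarith [W.hσ k], (W.hσwc k).trans (W.hwcw k)⟩) (hθwk_of_schedule W)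
    (hwk_of_schedule W) (hwk_anti_of_schedule W) (fun _ _ k _ _ hk => hdom k hk) hinv hdefwk hrate hlin

end Composition

/-! ## §4 The cutoff-free witness: a geometric schedule with a FINITE birth window -/

namespace WindowScheduleWin

/-- **A GEOMETRIC SCHEDULE** [decided toy]: for a ratio `0 < q < 1`, a fluctuation scale `σ₀ > 0` with `2σ₀ ≤ w`, a chart
radius `ϱ₀ > 0` and a final window `ρ∞`: `σ k = σ₀q^k`, `wc k = 2σ₀q^k`, `ϱc ≡ ϱ₀`, `ρw k = ρ∞ + c·q^k` with
`c = (1 + 2q)·σ₀/(1 − q)` — the gap holds with equality. [folklore] -/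
def geometric (r w q σ₀ ϱ₀ ρinf : ℝ) (hq0 : 0 < q) (hq1 : q < 1) (hσ₀ : 0 < σ₀) (hσ₀w : 2 * σ₀ ≤ w) (hϱ₀ : 0 < ϱ₀) :
    WindowScheduleWin r w where
  ρw k := ρinf + (1 + 2 * q) * σ₀ / (1 - q) * q ^ k
  σ k := σ₀ * q ^ k
  ϱc _ := ϱ₀
  wc k := 2 * σ₀ * q ^ k
  hσ k := by positivity
  hσwc k := le_of_eq (by ring)
  hwcw k := by
    have h : q ^ k ≤ 1 := pow_le_one₀ hq0.le hq1.le
    nlinarith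
  hwc_anti k := by
    have h : q ^ (k + 1) ≤ q ^ k := pow_le_pow_of_le_one hq0.le hq1.le (Nat.le_succ k)
    nlinarith
  hϱc _ := hϱ₀
  hgap k := by
    have h1 : (1 : ℝ) - q ≠ 0 := by linarith
    have e : ρinf + (1 + 2 * q) * σ₀ / (1 - q) * q ^ (k + 1) + 2 * σ₀ * q ^ (k + 1) + σ₀ * q ^ k =
        ρinf + (1 + 2 * q) * σ₀ / (1 - q) * q ^ k := by
      rw [pow_succ]
      field_simp
      ring
    exact e.le

/-- [decided toy] **THE BIRTH WINDOW IS CUTOFF-FREE**: every window of the geometric schedule has radius at most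
`ρ∞ + (1 + 2q)σ₀/(1 − q)` (`= ρw 0`) — the total (N1)/(N2) consumption along an arbitrarily long run is bounded by the
geometric sum, independently of the number of met steps (contrast `WindowSchedule.window_budget`: `K·w`). [folklore] -/
theorem geometric_window_le {r w q σ₀ ϱ₀ ρinf : ℝ} (hq0 : 0 < q) (hq1 : q < 1) (hσ₀ : 0 < σ₀) (hσ₀w : 2 * σ₀ ≤ w)
    (hϱ₀ : 0 < ϱ₀) (k : ℕ) :
    (geometric r w q σ₀ ϱ₀ ρinf hq0 hq1 hσ₀ hσ₀w hϱ₀).ρw k ≤ ρinf + (1 + 2 * q) * σ₀ / (1 - q) := by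
  show ρinf + (1 + 2 * q) * σ₀ / (1 - q) * q ^ k ≤ ρinf + (1 + 2 * q) * σ₀ / (1 - q)
  have hc : 0 ≤ (1 + 2 * q) * σ₀ / (1 - q) := div_nonneg (by positivity) (by linarith)
  have h : q ^ k ≤ 1 := pow_le_one₀ hq0.le hq1.le
  nlinarith

/-- [decided toy] The birth window itself: `ρw 0 = ρ∞ + (1 + 2q)σ₀/(1 − q)`. [folklore] -/
theorem geometric_birthWindow {r w q σ₀ ϱ₀ ρinf : ℝ} (hq0 : 0 < q) (hq1 : q < 1) (hσ₀ : 0 < σ₀) (hσ₀w : 2 * σ₀ ≤ w)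
    (hϱ₀ : 0 < ϱ₀) :
    (geometric r w q σ₀ ϱ₀ ρinf hq0 hq1 hσ₀ hσ₀w hϱ₀).ρw 0 = ρinf + (1 + 2 * q) * σ₀ / (1 - q) := by
  show ρinf + (1 + 2 * q) * σ₀ / (1 - q) * q ^ 0 = _
  rw [pow_zero, mul_one]

/-- [decided toy] **EVERY WINDOW CONTAINS THE FINAL ONE**: `ρ∞ ≤ ρw k` for all `k` — so with `0 ≤ ρ∞` the windows, fluctuation
domains and chart tubes are inhabited at EVERY step of EVERY cutoff with the same data (non-vacuity of §2's binders, uniformly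
in `K`). [folklore] -/
theorem geometric_window_ge {r w q σ₀ ϱ₀ ρinf : ℝ} (hq0 : 0 < q) (hq1 : q < 1) (hσ₀ : 0 < σ₀) (hσ₀w : 2 * σ₀ ≤ w)
    (hϱ₀ : 0 < ϱ₀) (k : ℕ) :
    ρinf ≤ (geometric r w q σ₀ ϱ₀ ρinf hq0 hq1 hσ₀ hσ₀w hϱ₀).ρw k := by
  show ρinf ≤ ρinf + (1 + 2 * q) * σ₀ / (1 - q) * q ^ k
  have hc : 0 ≤ (1 + 2 * q) * σ₀ / (1 - q) * q ^ k := mul_nonneg (div_nonneg (by positivity) (by linarith)) (by positivity)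
  linarith

/-- [decided toy] The zero background lies in every window of the geometric schedule when `0 ≤ ρ∞`, at EVERY step (no
condition on the number of steps — contrast `WindowSchedule.geometric_zero_mem_window`'s `(2w + r)·K ≤ ρ₀`). [folklore] -/
theorem geometric_zero_mem_window {R : Type*} [NormedRing R] {d : ℕ} {r w q σ₀ ϱ₀ ρinf : ℝ} (hq0 : 0 < q) (hq1 : q < 1)
    (hσ₀ : 0 < σ₀) (hσ₀w : 2 * σ₀ ≤ w) (hϱ₀ : 0 < ϱ₀) (hρ : 0 ≤ ρinf) (k : ℕ) :
    (0 : Fld d R) ∈ (bondBall d ((geometric r w q σ₀ ϱ₀ ρinf hq0 hq1 hσ₀ hσ₀w hϱ₀).ρw k) : Set (Fld d R)) := by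
  have h0 := hρ.trans (geometric_window_ge (r := r) hq0 hq1 hσ₀ hσ₀w hϱ₀ k)
  intro x ν
  simpa using h0

/-- [decided toy] **THE (w4) RATIO IS CUTOFF-FREE**: `θ/ϱ = 2σ₀q^k/ϱ₀ ≤ 2σ₀/ϱ₀`, so END-F-win's domination `hdom` holds along
the geometric schedule with the constant profile `α := fun _ => e³·(1 + 4·(2σ₀/ϱ₀))` (row S3's `alphaCell (2σ₀/ϱ₀)`). [folklore] -/
theorem geometric_ratio_le {r w q σ₀ ϱ₀ ρinf : ℝ} (hq0 : 0 < q) (hq1 : q < 1) (hσ₀ : 0 < σ₀) (hσ₀w : 2 * σ₀ ≤ w)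
    (hϱ₀ : 0 < ϱ₀) (k : ℕ) :
    4 * (2 * (geometric r w q σ₀ ϱ₀ ρinf hq0 hq1 hσ₀ hσ₀w hϱ₀).σ k) /
        (geometric r w q σ₀ ϱ₀ ρinf hq0 hq1 hσ₀ hσ₀w hϱ₀).ϱc k ≤ 4 * (2 * σ₀ / ϱ₀) := by
  show 4 * (2 * (σ₀ * q ^ k)) / ϱ₀ ≤ 4 * (2 * σ₀ / ϱ₀)
  have h : q ^ k ≤ 1 := pow_le_one₀ hq0.le hq1.le
  have h1 : 4 * (2 * (σ₀ * q ^ k)) ≤ 4 * (2 * σ₀) := by nlinarith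
  rw [show 4 * (2 * σ₀ / ϱ₀) = 4 * (2 * σ₀) / ϱ₀ by ring]
  exact div_le_div_of_nonneg_right h1 hϱ₀.le

/-- [decided toy] Hence END-F-win's `hdom` along the geometric schedule with a CONSTANT, cutoff-free profile. [folklore] -/
theorem geometric_hdom {r w q σ₀ ϱ₀ ρinf : ℝ} (hq0 : 0 < q) (hq1 : q < 1) (hσ₀ : 0 < σ₀) (hσ₀w : 2 * σ₀ ≤ w)
    (hϱ₀ : 0 < ϱ₀) {B : T4TermFormat.Booking} :
    ∀ k, k + 1 ≤ B.K →
      Real.exp 3 * (1 + 4 * (2 * (geometric r w q σ₀ ϱ₀ ρinf hq0 hq1 hσ₀ hσ₀w hϱ₀).σ k) /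
        (geometric r w q σ₀ ϱ₀ ρinf hq0 hq1 hσ₀ hσ₀w hϱ₀).ϱc k) ≤
      (fun _ : ℕ => Real.exp 3 * (1 + 4 * (2 * σ₀ / ϱ₀))) k := by
  intro k _
  have h := geometric_ratio_le (r := r) (ρinf := ρinf) hq0 hq1 hσ₀ hσ₀w hϱ₀ k
  have he : 0 < Real.exp 3 := Real.exp_pos 3
  show Real.exp 3 * (1 + 4 * (2 * (σ₀ * q ^ k)) / ϱ₀) ≤ Real.exp 3 * (1 + 4 * (2 * σ₀ / ϱ₀))
  have h' : 4 * (2 * (σ₀ * q ^ k)) / ϱ₀ ≤ 4 * (2 * σ₀ / ϱ₀) := h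
  nlinarith

end WindowScheduleWin

end Summit.QuantumFields.BalabanUV.T4Continuum.NE1p.DressedWindowScheduleWin

end
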